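import Summits.CriticalPhenomena.SAWScalingLimit.Theses.SAWLeftRightFKG
import Summits.CriticalPhenomena.SAWScalingLimit.Theorems.LeftRightFKG.Negative.LatticePolylines
import Summits.CriticalPhenomena.SAWScalingLimit.Theorems.BoundaryTP2Negative_Box3

/-!
# Line `one-jump-corner-certificate` — skeleton for crux `NotFKGAtOne` (stmt-CriticalPhenomena-11233)

Route `route-CriticalPhenomena-SAWLeftRightFKG`, crux decl
`Summit.CriticalPhenomena.SAWScalingLimit.Theses.SAWLeftRightFKG.NotFKGAtOne`
(`¬ ∀ …`: left–right FKG FAILS for the COUNTING measure — fugacity `x = 1` — on the chords of some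
lattice domain `Ω(C) = {wind(C, ·) ≠ 0}` between boundary-adjacent endpoints). Idea card
`Cruxes/NotFKGAtOne/Ideas/one-jump-corner-certificate.md` (ideator 1), sharpened by the triage panel
`TRIAGE-r1-{1,2,3}.md` (3 × pass); line card `Lines/one-jump-corner-certificate.md`.

## The line in one paragraph

The witness is the refuter's: the `3 × 3` vertex box `{0,1,2}²` cut out by the closed lattice walk
`sq3 = ∂[-1,3]²` (16 unit steps, `δ = 1`), chords `a = (0,0) → b = (2,2)` (`a' = (0,-1)`, `b' = (2,3)`
on `sq3`), events `A₃ = {1 ≤ wcross 0 0 γ}` (= first step North) and `B₃ = {1 ≤ wcross 1 1 γ}`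
(= last step East): `|U| = 12`, `|A₃| = |B₃| = 6`, `|A₃ ∩ B₃| = 2`, and `6 · 6 = 36 > 24 = 12 · 2`.
The ORDER side is already discharged, sorry-free, by the standing disproof (`Disproof.lean` §3,
copied in §0 below): crossing-count superlevel events are `≼`-up-closed in EVERY domain
(`le_wcross_of_lr`, from the landed `wcross_le_of_wind_nonneg`), and the four counts imply the crux
(`not_countFKG_sq3_of_counts3x3`). What is left — this line — is the COUNT side, cut into three stubs
along the two landed templates of the sibling crux (`Theorems/LeftRightFKG/Negative/BoxDomain.lean`,
`BoxMesh.lean`, the `5 × 4` box) and the landed enumeration of `Theorems/BoundaryTP2Negative_*`: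

* `stub_windSq3 : WindSq3` — the crux's domain `Ω(sq3)` CONTAINS the open square `(-1,3)²` and its
  lattice points lie in the box. This is where the card's "one jump" lever lives, in its landed
  `pathCross` clothing: the winding number of `sq3` about the face centre `(½,½)` is minus ONE signed
  crossing of the upward probe (`pathCross 0 0 c₀ sq3 = -1`, `decide`; `wind_poly_probeL`), hence `1`
  on the whole open square by connectedness; lattice points on the trace are junk `0`
  (`wind_eq_zero_of_mem_range`), points outside the closed square are `0` by the far field
  (`wind_poly_eq_zero_far`). Verbatim replay of `BoxDomain.lean` at `3 × 3`.
* `stub_dAdj : WindSq3 → DAdjSq3` — the discrete domain graph `Ω(sq3)_1` IS `ℤ²` induced on the box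
  (both directions): box segments lie in the convex open square `⊆ Ω ⊆ closure Ω` (mesh adjacency),
  row/column induction (preconnected), `meshDomain = meshVertices`
  (`Percolation.meshDomain_eq_meshVertices_of_preconnected`). Replay of `BoxMesh.lean`.
* `stub_counts : DAdjSq3 → Counts3x3` — the four `Measure.count` values: `DAdjSq3` makes
  `discreteDomainGraph (dom 1 sq3) 1 = discreteDomainGraph Ω₃ 1` (`graph_eq_Ω₃`, proved here), so the
  landed `nb₃`/`pathsFrom` enumeration of `Box3` applies: `γ ↦ γ.walk.support` is a bijection from the
  chords onto the kernel-decided list `chords₃` (12 supports, `Nodup`; `support_mem_chords₃`,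
  `exists_chord_of_mem_chords₃`, `support_injective` proved here from the hypothesis), the events read
  `evA`/`evB` on supports (`mem_A₃_iff`, `mem_B₃_iff`, `rfl`), the census `12/6/6/2` is `census_sq3`
  (`decide`, proved here), and `Measure.count = card` on the `⊤` σ-algebra (`count_apply_finite`).
  HARDEST (no verbatim template: the tree's enumeration lemmas bound `tsum`s, not cardinalities).

Composition (kernel-checked, no `sorry`): `NotFKGAtOne_of : Registered.stub_windSq3 →
Registered.stub_dAdj → Registered.stub_counts → SAWLeftRightFKG.NotFKGAtOne` :=
`notFKGAtOne_iff.2 ⟨1, …, sq3, not_countFKG_sq3_of_counts3x3 (h₃ (h₂ h₁))⟩`; `Registered.stub_X` is the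
`abbrev` alias of stub X's statement keyed by the stub's name (device of
`Cruxes/LeftRightFKG/Lines/corner-localisation.lean`), so the skeleton audit sees the hypotheses BY NAME.
`NotFKGAtOne_of` is the ONLY theorem of this file concluding the crux (the copied reduction is
re-concluded at `¬ CountFKG 1 … sq3`).

`Disproof.lean` used (cycle 1, rev 2026-08-16T03:09Z, read in full): §1 read-back and §3 witness copied
verbatim in §0 (the Cruxes work file is not an importable module); no `_false_without_` theorem, no
`-- Targets`, no landed `Theorems/NotFKGAtOne*/Negative` lemma exists (nothing to import in the scratch
check); §2 no-go's honoured: the witness has incomparable chords and non-nested `A₃`, `B₃`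
(`6, 6, 2`), non-degenerate data (`a ≠ b`, both in `Ω_1`), and lives on the non-distributive `ℤ²` chord
poset (backtracking chords of length 6, 8 are in the census); §4 S₁ (`|V| ≥ 8` necessary): `|V| = 9`.
-/

noncomputable section

open MeasureTheory Set Literature.Probability.LatticeModels Literature.Probability.RandomPlanarGeometry
  Literature.Topology.PlaneTopology
open Summit.CriticalPhenomena.SAWScalingLimit.Theses.SAWLeftRightFKG (NotFKGAtOne)
open Summit.CriticalPhenomena.SAWScalingLimit.Theorems.LeftRightFKG.Negative
open Summit.CriticalPhenomena.SAWScalingLimit.Theorems.BoundaryTP2.Negative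
  (pathsFrom endsAt eqSite eqSite_iff nb₃ inBox₃ inBox₃_iff Ω₃ adj₃_iff mem_nb₃ nb₃_adj T₃ mem_T₃_iff
   card_T₃ length_lt_card_of_adj_mem zdGraph_adj_cases zdGraph_adj_of_cases support_mem_pathsFrom
   exists_walk_of_mem_pathsFrom walk_eq_of_support_eq endsAt_support)
open scoped ENNReal

namespace Summit.CriticalPhenomena.SAWScalingLimit.Cruxes.NotFKGAtOne.OneJumpCornerCertificate

/-! ## §0 Read-back of the crux and the standing disproof's witness (verbatim from `Disproof.lean` §1, §3) -/

/-- `Ω(C, δ)`: the points of non-zero winding number of the mesh polyline of the closed lattice walk `C`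
(verbatim the `let Ω` of the crux). [folklore] -/
def dom (δ : ℝ) {c : Site 2} (C : (zdGraph 2).Walk c c) : Set ℂ :=
  {z | wind (fun t : ℝ => IccExtend zero_le_one (C.toCurve (meshPoint δ)) t - z) ≠ 0}

/-- The left–right preorder of the crux (verbatim its `let le`): the lens loop `γ₁ · γ₂⁻¹` winds
non-negatively about every point. [folklore] -/
def lr {Ω : Set ℂ} {δ : ℝ} {a b : Site 2} (γ₁ γ₂ : SAW.DomainSAW Ω δ a b) : Prop :=
  ∀ z : ℂ, 0 ≤ wind (fun t : ℝ =>
    IccExtend zero_le_one ((γ₁.walk.append γ₂.walk.reverse).toCurve (meshPoint δ)) t - z)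

/-- `CountFKG δ c a b a' b' C`: the ∀-body of the crux at one datum — left–right FKG in event form for the
COUNTING measure on the chords of `Ω(C)_δ` from `a` to `b`. [folklore] -/
def CountFKG (δ : ℝ) (c a b a' b' : Site 2) (C : (zdGraph 2).Walk c c) : Prop :=
  0 < δ → a' ∈ C.support → b' ∈ C.support → (zdGraph 2).Adj a a' → (zdGraph 2).Adj b b' →
  ∀ A B : Set (SAW.DomainSAW (dom δ C) δ a b), (∀ γ₁ γ₂, lr γ₁ γ₂ → γ₁ ∈ A → γ₂ ∈ A) →
    (∀ γ₁ γ₂, lr γ₁ γ₂ → γ₁ ∈ B → γ₂ ∈ B) →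
    Measure.count A * Measure.count B ≤
      Measure.count (univ : Set (SAW.DomainSAW (dom δ C) δ a b)) * Measure.count (A ∩ B)

/-- READ-BACK: the crux is the existential "some datum violates `CountFKG`" (an `Iff`, so it does not
count as a theorem concluding the crux). [folklore] -/
theorem notFKGAtOne_iff :
    NotFKGAtOne ↔ ∃ (δ : ℝ) (c a b a' b' : Site 2) (C : (zdGraph 2).Walk c c), ¬ CountFKG δ c a b a' b' C := by
  have h : NotFKGAtOne ↔ ¬ ∀ (δ : ℝ) (c a b a' b' : Site 2) (C : (zdGraph 2).Walk c c),
      CountFKG δ c a b a' b' C := Iff.rfl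
  simp only [h, not_forall]

/-- Lattice point `(x, y)`. [folklore] -/
def P (x y : ℤ) : Site 2 := ![x, y]

/-- One explicit step of a lattice walk (pins the intermediate vertex for `decide`). [folklore] -/
abbrev stepTo {u w : Site 2} (v : Site 2) (h : (zdGraph 2).Adj u v) (p : (zdGraph 2).Walk v w) :
    (zdGraph 2).Walk u w :=
  SimpleGraph.Walk.cons h p

/-- The boundary `C₃` of the square `[-1,3]²`, a closed lattice walk of length 16 based at `(-1,-1)`
(counter-clockwise) — the refuter's `sq3`. [folklore] -/
def sq3 : (zdGraph 2).Walk (P (-1) (-1)) (P (-1) (-1)) :=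
  stepTo (P 0 (-1)) (by decide) <| stepTo (P 1 (-1)) (by decide) <| stepTo (P 2 (-1)) (by decide) <|
  stepTo (P 3 (-1)) (by decide) <| stepTo (P 3 0) (by decide) <| stepTo (P 3 1) (by decide) <|
  stepTo (P 3 2) (by decide) <| stepTo (P 3 3) (by decide) <| stepTo (P 2 3) (by decide) <|
  stepTo (P 1 3) (by decide) <| stepTo (P 0 3) (by decide) <| stepTo (P (-1) 3) (by decide) <|
  stepTo (P (-1) 2) (by decide) <| stepTo (P (-1) 1) (by decide) <| stepTo (P (-1) 0) (by decide) <|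
  stepTo (P (-1) (-1)) (by decide) <| SimpleGraph.Walk.nil

/-- `(0,-1)` is a boundary vertex (below `a = (0,0)`). [folklore] -/
theorem mem_sq3_support_a' : P 0 (-1) ∈ sq3.support := by decide

/-- `(2,3)` is a boundary vertex (above `b = (2,2)`). [folklore] -/
theorem mem_sq3_support_b' : P 2 3 ∈ sq3.support := by decide

/-- The chords of the witness: SAWs of `Ω(sq3)_1` from the corner `(0,0)` to the corner `(2,2)`. [folklore] -/
abbrev Chord := SAW.DomainSAW (dom 1 sq3) 1 (P 0 0) (P 2 2)

/-- **Crossing-count superlevel events are `≼`-up-closed — in EVERY domain (`δ = 1`), unconditionally**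
(the refuter's `le_wcross_of_lr`, from the landed `wcross_le_of_wind_nonneg`). [folklore] -/
theorem le_wcross_of_lr {Ω : Set ℂ} {a b : Site 2} (m k c : ℤ) (γ₁ γ₂ : SAW.DomainSAW Ω 1 a b)
    (h : lr γ₁ γ₂) (h₁ : c ≤ wcross m k γ₁.walk) : c ≤ wcross m k γ₂.walk := by
  have hG : ∀ x y, (discreteDomainGraph Ω 1).Adj x y → (zdGraph 2).Adj x y := fun x y hxy =>
    meshGraph_le_zdGraph Ω 1 (discreteDomainGraph_le_meshGraph Ω 1 hxy)
  classical
  obtain ⟨Y, hY⟩ := Finset.exists_le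
    (insert k (((γ₁.walk.support ++ γ₂.walk.support).map fun x : Site 2 => x 1).toFinset))
  have hkY : k ≤ Y := hY k (Finset.mem_insert_self _ _)
  have hs : ∀ x ∈ γ₁.walk.support ++ γ₂.walk.support, x 1 ≤ Y := fun x hx =>
    hY (x 1) (Finset.mem_insert_of_mem (List.mem_toFinset.2 (List.mem_map.2 ⟨x, hx, rfl⟩)))
  have key := wcross_le_of_wind_nonneg hG γ₁.walk γ₂.walk hkY
    (fun x hx => hs x (List.mem_append_left _ hx)) (fun x hx => hs x (List.mem_append_right _ hx))
    (h (probeL m k))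
  omega

/-- The corner event at `a`: `A₃ = {γ | 1 ≤ wcross 0 0 γ}` = {first step North} on the box. [folklore] -/
def A₃ : Set Chord := {γ | 1 ≤ wcross 0 0 γ.walk}

/-- The corner event at `b`: `B₃ = {γ | 1 ≤ wcross 1 1 γ}` = {last step East}. [folklore] -/
def B₃ : Set Chord := {γ | 1 ≤ wcross 1 1 γ.walk}

/-- `A₃` is `≼`-up-closed (PROVED, no side condition). [folklore] -/
theorem isUp_A₃ : ∀ γ₁ γ₂, lr γ₁ γ₂ → γ₁ ∈ A₃ → γ₂ ∈ A₃ :=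
  fun γ₁ γ₂ h h₁ => le_wcross_of_lr 0 0 1 γ₁ γ₂ h h₁

/-- `B₃` is `≼`-up-closed (PROVED, no side condition). [folklore] -/
theorem isUp_B₃ : ∀ γ₁ γ₂, lr γ₁ γ₂ → γ₁ ∈ B₃ → γ₂ ∈ B₃ :=
  fun γ₁ γ₂ h h₁ => le_wcross_of_lr 1 1 1 γ₁ γ₂ h h₁

/-- **The remaining obligation of the crux** (verbatim the refuter's `Counts3x3`, whose sorried
`counts3x3` this line proves): the four counts of the `3 × 3` witness. [folklore] -/
def Counts3x3 : Prop :=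
  Measure.count A₃ = 6 ∧ Measure.count B₃ = 6 ∧
    Measure.count (univ : Set Chord) = 12 ∧ Measure.count (A₃ ∩ B₃) = 2

/-- The refuter's sorry-free reduction, re-concluded one step BEFORE the crux (so that `NotFKGAtOne_of`
below is the only theorem of this file concluding the crux by name): the four counts violate
`CountFKG` at the datum `(1, sq3, (0,0), (2,2), (0,-1), (2,3))` — `δ = 1 > 0`, `a' ∈ C₃`, `b' ∈ C₃`,
`a ∼ a'`, `b ∼ b'` by `decide`, up-closedness by `isUp_A₃`/`isUp_B₃`, then `36 ≤ 24` is false. [folklore] -/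
theorem not_countFKG_sq3_of_counts3x3 (h : Counts3x3) :
    ¬ CountFKG 1 (P (-1) (-1)) (P 0 0) (P 2 2) (P 0 (-1)) (P 2 3) sq3 := by
  intro hC
  obtain ⟨cA, cB, cU, cAB⟩ := h
  have key := hC one_pos mem_sq3_support_a' mem_sq3_support_b' (by decide) (by decide) A₃ B₃ isUp_A₃ isUp_B₃
  rw [cA, cB, cU, cAB] at key
  have e1 : (6 : ℝ≥0∞) * 6 = ((36 : ℕ) : ℝ≥0∞) := by norm_num
  have e2 : (12 : ℝ≥0∞) * 2 = ((24 : ℕ) : ℝ≥0∞) := by norm_num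
  rw [e1, e2] at key
  exact absurd (Nat.cast_le.1 key) (by norm_num)

/-! ## §1 The statements of the line -/

/-- The open square `(-1, 3)²` — the interior of the boundary walk `sq3`. [folklore] -/
def Rint3 : Set ℂ := {z | (-1 < z.re ∧ z.re < 3) ∧ (-1 < z.im ∧ z.im < 3)}

/-- STATEMENT OF STUB 1 (the analytic half of the domain identification): the crux's domain
`Ω(sq3) = {wind(sq3, ·) ≠ 0}` CONTAINS the open square `(-1,3)²`, and every lattice point of `Ω(sq3)`
lies in the vertex box `{0,1,2}²` (lattice points of `∂[-1,3]²` are on the trace: junk `0`; lattice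
points outside `[-1,3]²`: winding `0`). Shape of the landed `Rint_subset_Ωb` + `meshVertices_Ωb` (⊆). [folklore] -/
def WindSq3 : Prop :=
  Rint3 ⊆ dom 1 sq3 ∧ meshVertices (dom 1 sq3) 1 ⊆ boxSites ![0, 0] ![2, 2]

/-- STATEMENT OF STUB 2's conclusion (the combinatorial half): adjacency in the crux's discrete domain
graph `Ω(sq3)_1 = discreteDomainGraph (dom 1 sq3) 1` is lattice adjacency inside the box — literally
the right-hand side of `BoundaryTP2.Negative.adj₃_iff` for `Ω₃`, so the two graphs are EQUAL
(`graph_eq_Ω₃`). Shape of the landed `BoxMesh.dAdj_iff`. [folklore] -/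
def DAdjSq3 : Prop :=
  ∀ x y : Site 2, (discreteDomainGraph (dom 1 sq3) 1).Adj x y ↔
    (zdGraph 2).Adj x y ∧ x ∈ boxSites ![0, 0] ![2, 2] ∧ y ∈ boxSites ![0, 0] ![2, 2]

/-! ## §2 Registered stubs -/

/-- STUB 1 (M; the "one jump" = one signed crossing): `WindSq3`. Route (template
`Theorems/LeftRightFKG/Negative/BoxDomain.lean`, the `5 × 4` box, 330 lines — replay at `3 × 3`):
`pathCross 0 0 (P (-1) (-1)) sq3.support.tail = -1` (`decide`) ⇒ `wind(sq3 − probeL 0 0) = 1`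
(`wind_poly_probeL` with `Y = 3`, `iccExtend_toCurve_apply`, `poly_fst_walk`); the trace lies on the four
lines `im = -1 ∨ re = 3 ∨ im = 3 ∨ re = -1` (`range_poly_subset_of_isChain`, `decide`d chain), hence in
`Rint3ᶜ`, so `wind = 1` on the convex open square (`wind_sub_eq_of_mem_connectedComponentIn`) — conjunct 1;
a lattice point `x ∈ Ω(sq3)` outside the box is either outside `[-1,3]²` (`wind_poly_eq_zero_far`,
`range_poly_subset` into the closed square, four half-line escapes — copy `not_mem_Ωb_of_not_mem_Rcl`) or
on `∂[-1,3]² ∩ ℤ² ⊆ sq3.support` (`interval_cases`; `wind_eq_zero_of_mem_range`,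
`mem_range_polylineFrom`) — conjunct 2. [folklore] -/
theorem stub_windSq3 : WindSq3 := by
  sorry

/-- STUB 2 (S/M): `WindSq3 → DAdjSq3`. Route (template `Theorems/LeftRightFKG/Negative/BoxMesh.lean`,
130 lines): from conjunct 1, box sites are mesh vertices (`pt x ∈ Rint3` by `norm_cast`/`linarith`) and
with conjunct 2 `meshVertices (dom 1 sq3) 1 = boxSites ![0,0] ![2,2]`; box neighbours are
`meshGraph`-adjacent (`meshGraph_adj_iff`: the unit segment lies in the convex `Rint3 ⊆ Ω ⊆ closure Ω`,
`Convex.segment_subset`, `meshPoint_one`); the mesh graph on the box is preconnected (row/column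
induction from `(0,0)`, `bx`/`adj_bx`); hence `meshDomain (dom 1 sq3) 1 = meshVertices …`
(`Literature.Probability.Percolation.meshDomain_eq_meshVertices_of_preconnected`) and
`discreteDomainGraph_adj_iff` + `meshGraph_le_zdGraph` give both directions; finish with
`mem_boxSites_iff`/`Fin.forall_fin_two` bookkeeping between the two box spellings. [folklore] -/
theorem stub_dAdj : WindSq3 → DAdjSq3 := by
  sorry

/-- STUB 3 (M, HARDEST — no verbatim template): `DAdjSq3 → Counts3x3`, the four `Measure.count` values
`6, 6, 12, 2`. Route: the glue of §3 below (all proved from the hypothesis) — `graph_eq_Ω₃`,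
`support_mem_chords₃` / `exists_chord_of_mem_chords₃` / `support_injective` (so `γ ↦ γ.walk.support`
is a bijection `Chord → {s // s ∈ chords₃}`, in particular `Finite Chord` / a `Fintype` by
`Fintype.ofList` + surjectivity), `mem_A₃_iff` / `mem_B₃_iff` (the events are the Boolean `evA`/`evB`
read on supports, `rfl`), the kernel census `census_sq3` (`12/6/6/2`, `Nodup`); then
`Measure.count S = S.toFinset.card` on the `⊤` σ-algebra (`Measure.count_apply_finite'` with
`MeasurableSpace.measurableSet_top`, or `count_apply_finite` via a `MeasurableSingletonClass` one-liner)
and `Finset.card_bij`/`List.toFinset_card_of_nodup` transport each count to a `List.filter` length.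
[folklore] -/
theorem stub_counts : DAdjSq3 → Counts3x3 := by
  sorry

/-! ## §3 Glue available to the stub provers (sorry-free): what `DAdjSq3` buys, and the kernel census -/

/-- Under `DAdjSq3` the crux's domain graph IS the tree's `Ω₃` box graph (`BoundaryTP2Negative_Box3`),
so `nb₃`, `pathsFrom`, `length_le_eight` transfer. [folklore] -/
theorem graph_eq_Ω₃ (h : DAdjSq3) : discreteDomainGraph (dom 1 sq3) 1 = discreteDomainGraph Ω₃ 1 := by
  ext x y
  exact (h x y).trans adj₃_iff.symm

/-- `nb₃` lists all neighbours of the sq3 domain graph (completeness), under `DAdjSq3`. [folklore] -/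
theorem mem_nb₃_sq3 (h : DAdjSq3) (u w : Site 2) (huw : (discreteDomainGraph (dom 1 sq3) 1).Adj u w) :
    w ∈ nb₃ u := by
  rw [graph_eq_Ω₃ h] at huw
  exact mem_nb₃ u w huw

/-- `nb₃` lists only neighbours of the sq3 domain graph (soundness), under `DAdjSq3`. [folklore] -/
theorem nb₃_adj_sq3 (h : DAdjSq3) (u w : Site 2) (hw : w ∈ nb₃ u) :
    (discreteDomainGraph (dom 1 sq3) 1).Adj u w := by
  rw [graph_eq_Ω₃ h]
  exact nb₃_adj u w hw

/-- Every chord has at most `8` steps (nine vertices), under `DAdjSq3`. [folklore] -/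
theorem length_le_eight_sq3 (h : DAdjSq3) (γ : Chord) : γ.length ≤ 8 := by
  have hT := length_lt_card_of_adj_mem (G := discreteDomainGraph (dom 1 sq3) 1) T₃
    (fun x y hxy => ⟨(mem_T₃_iff x).2 ((h x y).1 hxy).2.1, (mem_T₃_iff y).2 ((h x y).1 hxy).2.2⟩)
    ((mem_T₃_iff (P 0 0)).2 (by decide)) γ.walk γ.isPath
  have hc := card_T₃
  change γ.walk.length ≤ 8
  omega

/-- The enumerated chord supports `(0,0) → (2,2)` of the box (landed `pathsFrom` of `Box3`, fuel `8`). [folklore] -/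
def chords₃ : List (List (Site 2)) :=
  (pathsFrom eqSite nb₃ 8 (P 0 0) []).filter (endsAt eqSite (P 2 2))

/-- The event `A₃` read on a support list: `1 ≤ pathCross 0 0 (0,0) tail`. [folklore] -/
def evA (s : List (Site 2)) : Bool := decide (1 ≤ pathCross 0 0 (P 0 0) s.tail)

/-- The event `B₃` read on a support list: `1 ≤ pathCross 1 1 (0,0) tail`. [folklore] -/
def evB (s : List (Site 2)) : Bool := decide (1 ≤ pathCross 1 1 (P 0 0) s.tail)

/-- `A₃` is `evA` of the support (`wcross m k w = pathCross m k u w.support.tail` by `rfl`). [folklore] -/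
theorem mem_A₃_iff (γ : Chord) : γ ∈ A₃ ↔ evA γ.walk.support = true := by
  rw [evA, decide_eq_true_iff]
  exact Iff.rfl

/-- `B₃` is `evB` of the support. [folklore] -/
theorem mem_B₃_iff (γ : Chord) : γ ∈ B₃ ↔ evB γ.walk.support = true := by
  rw [evB, decide_eq_true_iff]
  exact Iff.rfl

/-- **The kernel-decided census of the witness**: 12 chord supports, 6 in `A₃`, 6 in `B₃`, 2 in both,
no duplicates (the refuter's table: EENN ENEN ENNE NEEN NENE NNEE; EENWNE ENWNEE NESENN NNESEN; EENWWNEE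
NNESSENN; `A₃ ∩ B₃ = {NENE, NNEE}`). [folklore] -/
theorem census_sq3 :
    chords₃.length = 12 ∧ (chords₃.filter evA).length = 6 ∧ (chords₃.filter evB).length = 6 ∧
      (chords₃.filter fun s => evA s && evB s).length = 2 ∧ chords₃.Nodup := by
  decide

/-- Completeness: the support of every chord is listed in `chords₃`, under `DAdjSq3`. [folklore] -/
theorem support_mem_chords₃ (h : DAdjSq3) (γ : Chord) : γ.walk.support ∈ chords₃ :=
  List.mem_filter.2 ⟨support_mem_pathsFrom eqSite_iff (mem_nb₃_sq3 h) 8 γ.walk [] γ.isPath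
    (length_le_eight_sq3 h γ) (by simp), endsAt_support eqSite_iff γ.walk⟩

/-- Soundness: every listed support is the support of a chord, under `DAdjSq3`. [folklore] -/
theorem exists_chord_of_mem_chords₃ (h : DAdjSq3) {s : List (Site 2)} (hs : s ∈ chords₃) :
    ∃ γ : Chord, γ.walk.support = s := by
  unfold chords₃ at hs
  rw [List.mem_filter] at hs
  obtain ⟨v, p, hp, hsupp, -⟩ := exists_walk_of_mem_pathsFrom eqSite_iff (nb₃_adj_sq3 h) 8 [] s hs.1
  have hvb : v = P 2 2 := by
    have h1 := hs.2
    unfold endsAt at h1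
    rw [← hsupp, List.getLast?_eq_some_getLast p.support_ne_nil, SimpleGraph.Walk.getLast_support] at h1
    exact (eqSite_iff v _).1 h1
  subst hvb
  exact ⟨⟨p, hp⟩, hsupp⟩

/-- A chord is determined by its support. [folklore] -/
theorem support_injective : Function.Injective fun γ : Chord => γ.walk.support := by
  intro γ γ' hγ
  have hw := walk_eq_of_support_eq γ.walk γ'.walk hγ
  cases γ; cases γ'
  simp only at hw
  subst hw
  rfl

/-! ## §4 Name-keyed aliases of the three stub statements (hypotheses of the composition)

`Registered.stub_X` is the statement of `stub_X` under the registered stub's short name, so that the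
native skeleton audit (`#h21_check_skeleton`: hypotheses admissible iff registered obligations / declared
stubs BY NAME) accepts `NotFKGAtOne_of : Registered.stub_windSq3 → … → NotFKGAtOne`. -/
namespace Registered

/-- Alias of `WindSq3` keyed by the registered stub name. [folklore] -/
abbrev stub_windSq3 : Prop := WindSq3
/-- Alias of `WindSq3 → DAdjSq3` keyed by the registered stub name. [folklore] -/
abbrev stub_dAdj : Prop := WindSq3 → DAdjSq3
/-- Alias of `DAdjSq3 → Counts3x3` keyed by the registered stub name. [folklore] -/
abbrev stub_counts : Prop := DAdjSq3 → Counts3x3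

end Registered

/-! ## §5 Composition (kernel-checked, no `sorry`) -/

/-- THE LINE: the three stub statements (keyed by the stubs' names) imply the crux BY NAME — the witness
datum `(δ, c, a, b, a', b', C) = (1, (-1,-1), (0,0), (2,2), (0,-1), (2,3), sq3)` violates `CountFKG`. [folklore] -/
theorem NotFKGAtOne_of (h₁ : Registered.stub_windSq3) (h₂ : Registered.stub_dAdj)
    (h₃ : Registered.stub_counts) :
    Summit.CriticalPhenomena.SAWScalingLimit.Theses.SAWLeftRightFKG.NotFKGAtOne :=
  notFKGAtOne_iff.2 ⟨1, P (-1) (-1), P 0 0, P 2 2, P 0 (-1), P 2 3, sq3,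
    not_countFKG_sq3_of_counts3x3 (h₃ (h₂ h₁))⟩

/-- WIRING CHECK: the three registered stubs feed `NotFKGAtOne_of` as stated (an `example`, so that
`NotFKGAtOne_of` stays the only theorem concluding the crux). -/
example : Summit.CriticalPhenomena.SAWScalingLimit.Theses.SAWLeftRightFKG.NotFKGAtOne :=
  NotFKGAtOne_of stub_windSq3 stub_dAdj stub_counts

end Summit.CriticalPhenomena.SAWScalingLimit.Cruxes.NotFKGAtOne.OneJumpCornerCertificate

end
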